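import Mathlib.Topology.ContinuousMap.Compact
import Mathlib.Topology.UnitInterval
import Mathlib.Topology.MetricSpace.Polish
import Mathlib.Analysis.Convex.Segment
import Mathlib.Analysis.Complex.Basic
import Mathlib.MeasureTheory.Measure.FiniteMeasure
import Mathlib.MeasureTheory.Constructions.BorelSpace.Basic
import Literature.Probability.Percolation.Percolation
import Literature.Probability.LatticeModels.IsoradialGraphs
import HarnessLib

/-!
# The Schramm–Smirnov space of quad-crossing configurations and the laws of discrete percolation

Topic `Literature/Probability/Percolation`; definition request `defn-QuadCrossingLimitLaws` (route
`Summits/CriticalPhenomena/CardyFormulaZ2/Theses/CardyOrderDuality`; idea cards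
cle6-local-rigidity-connected-limits, scale-ergodic-quenched-upgrade, monotone-approach-lyapunov,
canonical-gluing-comparison).

**Source (held, read: arXiv:1101.5820, §1.3 and §1.4).**  O. Schramm, S. Smirnov (with an appendix
by C. Garban), *On the scaling limits of planar percolation*, Ann. Probab. 39 (2011) 1768–1814,
§1.3 "The space of percolation configurations":

* "A quad in `D` is a topological quadrilateral, that is, a homeomorphism
  `Q : [0,1]² → Q([0,1]²) ⊂ D`. … The space of all such quads will be denoted by `𝒬 = 𝒬_D`.  It is
  a metric space under the uniform metric `d(Q₁, Q₂) = sup_{z ∈ [0,1]²} |Q₁(z) − Q₂(z)|`."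
* "A crossing of `Q` is a connected compact subset of `[Q] := Q([0,1]²)` that intersects both
  opposite sides `∂₀Q := Q({0} × [0,1])` and `∂₂Q := Q({1} × [0,1])`.  We also denote the remaining
  two sides by `∂₁Q := Q([0,1] × {0})` and `∂₃Q := Q([0,1] × {1})`."
* "If `Q₁, Q₂ ∈ 𝒬_D`, we write `Q₁ ≤ Q₂` if every crossing of `Q₂` contains a crossing of `Q₁`. …
  we write `Q₁ < Q₂` if there are open (in the uniform metric) neighborhoods `U₁` of `Q₁` and `U₂`
  of `Q₂` in `𝒬_D`, such that for every `Q ∈ U₁` and `Q' ∈ U₂` we have `Q ≤ Q'`.  Thus, the set of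
  pairs `(Q, Q')` satisfying `Q < Q'` is the interior of `{(Q, Q') : Q ≤ Q'}` in the product
  topology."
* "A subset `S ⊂ 𝒬_D` is a lower set if, whenever `Q ∈ S` and `Q' ∈ 𝒬_D` satisfies `Q' < Q`, we
  also have `Q' ∈ S`.  The collection of all closed lower subsets of `𝒬_D` will be denoted `ℋ_D`.
  Any discrete percolation configuration `ω` … is naturally associated with an element `S_ω` of
  `ℋ_D`: the set of all quads for which `ω` contains a crossing formed by an open cluster.  Thus,
  a percolation model on the tiling `H_η` induces a probability measure `μ_η` on `ℋ`".
* "A topology is defined on `ℋ_D` by specifying a subbase.  If `U ⊂ 𝒬_D` is topologically open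
  and `Q ∈ 𝒬_D`, let `V_U := {S ∈ ℋ_D : S ∩ U ≠ ∅}` and `V^Q := {S ∈ ℋ_D : Q ∉ S}`. … Our topology
  of choice on `ℋ_D` will be the minimal topology `𝒯_D` which contains every such `V_U` and `V^Q`.
  … the scaling limit measure is a Borel probability measure on `ℋ`.  Then the event of a
  percolation configuration crossing a quad `Q` corresponds to `⊞_Q := ¬V^Q = {S : Q ∈ S}`."
* Theorem 1.4 (vendored below as the one named fact of this file): for `D` open nonempty,
  (1) `(ℋ_D, 𝒯_D)` is a compact metrizable Hausdorff space; (2) if `A ⊂ 𝒬_D` is dense and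
  `S₁ ∩ A = S₂ ∩ A` then `S₁ = S₂`, and the `σ`-field generated by `V^Q`, `Q ∈ A`, is the Borel
  `σ`-field.  Cor. 1.5–1.6 (compactness of the space of Borel probability measures; precompactness
  of the discrete laws `μ_η` — "the existence of percolation subsequential scaling limits is an
  immediate corollary").  Remark 8: convergence along sequences `η_j → 0` suffices.

**Contents** (namespace `Literature.Probability.Percolation.QuadCrossing`; `D : Set ℂ`).

* `Quad D` (a continuous injective `[0,1]² → ℂ` with range in `D`; on the compact square
  injective + continuous = homeomorphism onto the image), its uniform metric (induced from
  `C([0,1]², ℂ)`), `carrier = [Q]`, `side k = ∂ₖQ`;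
  `Quad.IsCrossing Q K`; the SS11 orders `Quad.Dominated Q₁ Q₂` (`Q₁ ≤ Q₂`) and
  `Quad.StrictlyDominated Q₁ Q₂` (`Q₁ < Q₂`, the interior of `≤`), with `refl`/`trans`/`le`.
* `IsLowerQuadSet S`; the space `QuadConfig D = ℋ_D` of closed lower sets with the topology `𝒯_D`
  (`TopologicalSpace.generateFrom` on the printed subbase), its Borel `σ`-algebra, the crossing
  events `crossedEvent Q = ⊞_Q` (closed, measurable: `isClosed_crossedEvent`,
  `measurableSet_crossedEvent`), the inclusion order on `ℋ_D` (increasing events = upper sets).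
* `QuadConfig.ofDominatedLower`: the closure of a `≤`-lower set of quads is a closed `<`-lower set
  (PROVED, `isLowerQuadSet_closure`), whence the discrete configuration map:
  `openEdgeRealization z δ ω ⊂ ℂ` (the union of the segments `[δ z x, δ z y]` over the open edges
  `s(x, y) ∈ ω` of a bond configuration with vertex positions `z : V → ℂ` at mesh `δ`),
  `rawCrossedQuads` (the quads having a crossing inside it — `≤`-lower, PROVED) and
  `configOf z δ ω : QuadConfig D` = its closure (SS11's `S_ω`; for locally finite realisations the
  raw set is already closed — a Hausdorff-limit argument — so the closure only discharges that
  proof obligation and does not change the object; recorded, not proved here).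
* Laws: `crossingLaw P z δ : FiniteMeasure (QuadConfig D)`, the push-forward of a bond-percolation
  law `P` (junk value `0` if `configOf z δ` were not measurable — it is, by Thm. 1.4 (2) and the
  finite dependence of `⊞_Q` on edges meeting `[Q]`, a theorem left to a proof file); the bond-`ℤ²`
  law at `p = 1/2`, `squareCrossingLaw D δ` (positions `squareLatticeEmbedding.z`, measure
  `bondPercolation (zdGraph 2) half`); `IsSubseqQuadLimit μ` (weak limit of `squareCrossingLaw D δₖ`
  along some `δₖ → 0⁺`, in Mathlib's topology of weak convergence on `FiniteMeasure`) and the set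
  `subseqQuadLimits D` (the route's `Λ`).
* The stochastic (FKG) order on laws, `StochDominated μ ν`: `μ A ≤ ν A` for every increasing event
  `A` measurable with respect to finitely many crossing events (`IsCrossingCylinder`), as requested
  (the equivalent monotone-coupling form, Strassen, is a theorem, not restated).
* Dilations and motions: `Quad.mapContinuous` (composition with a continuous injective plane map
  carrying `D` into `D'`), `Quad.dilate t`, `Quad.isometry g`, and for a plane homeomorphism `g`
  the self-homeomorphism `Quad.congrHomeomorph g` of `𝒬_ℂ` (PROVED: continuity for the uniform =
  compact-open topology, crossings go to crossings, `≤` and `<` are preserved —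
  `Quad.IsCrossing.image`, `Quad.Dominated.mapHomeomorph`, `Quad.StrictlyDominated.mapHomeomorph`),
  whence the action on configurations `QuadConfig.mapHomeomorph g` (closed lower sets go to closed
  lower sets, PROVED), Schramm–Smirnov's scaling `QuadConfig.dilate t = S_t`, motions
  `QuadConfig.isometry g`, and the push-forwards on laws `dilateLaw t`, `isometryLaw g` (the route's
  `S_t Λ`).  NOT delivered: the duality involution `S ↦ S*` requested as (e) — the source discusses
  duality only informally (§1.1–1.2: "the crossing of a quad by open tiles occurs iff there is no
  dual (closed) crossing between the other two sides") and prints no involution on `ℋ_D` (on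
  `ℋ_D` it is only defined almost surely, the complement of a closed lower set not being closed);
  it needs Thm. 1.4 (2) and should be filed as its own item with a chosen a.s. convention.

## Mathlib / tree search

Mathlib: `unitInterval`, `ContinuousMap` with its sup metric on a compact domain
(`ContinuousMap.instMetricSpace`), `MetricSpace.induced`, `TopologicalSpace.generateFrom`, `borel`,
`segment`, `Measure.map`, `FiniteMeasure` with the topology of weak convergence, `IsUpperSet`;
no quads / Schramm–Smirnov space (`lean search 'Quad|quadCross|Schramm'`: only unrelated
`QuadraticForm`, and the tree's `ConformalRectangle`, a rectangle with FOUR MARKED boundary arcs of a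
Jordan domain — a different object, not parametrised by the square).  Tree: `BondConfig`,
`bondPercolation`, `zdGraph`, `squareLatticeEmbedding`, `half`.  Nothing duplicates an existing
declaration; exactly one named fact (Thm. 1.4 (1)–(2)) is introduced.

## References

* O. Schramm, S. Smirnov, *On the scaling limits of planar percolation*, Ann. Probab. 39 (2011),
  1768–1814 (arXiv:1101.5820), §1.3, Thm. 1.4, Cor. 1.5–1.6, Remark 8. [SchrammSmirnov2011]
-/

noncomputable section

open scoped Topology unitInterval
open Set Filter MeasureTheory Metric

namespace Literature.Probability.Percolation

namespace QuadCrossing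

/-! ### Quads -/

/-- A **quad** in `D ⊆ ℂ` (Schramm–Smirnov: "a topological quadrilateral, that is, a homeomorphism
`Q : [0,1]² → Q([0,1]²) ⊂ D`"): a continuous injective map of the unit square into the plane with
image in `D` (on the compact square, continuous + injective is a homeomorphism onto the image).
Quads are kept parametrised, as in the source ("We introduce some redundancy …").
[cite: SchrammSmirnov2011, §1.3] -/
structure Quad (D : Set ℂ) where
  /-- The parametrisation of the quad by the unit square. -/
  toFun : I × I → ℂ
  /-- The parametrisation is continuous. -/
  continuous_toFun : Continuous toFun
  /-- The parametrisation is injective. -/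
  injective_toFun : Function.Injective toFun
  /-- The quad lies in `D`. -/
  range_subset : range toFun ⊆ D

namespace Quad

variable {D D' : Set ℂ}

/-- The instance `instCoeFun` (see the module docstring). [folklore] -/
instance instCoeFun : CoeFun (Quad D) (fun _ => I × I → ℂ) := ⟨Quad.toFun⟩

/-- The quad as a continuous map on the square. [cite: SchrammSmirnov2011, §1.3] -/
def toContinuousMap (Q : Quad D) : C(I × I, ℂ) := ⟨Q.toFun, Q.continuous_toFun⟩

/-- `toContinuousMap_apply`: structural lemma for the definitions above. [folklore] -/
@[simp] theorem toContinuousMap_apply (Q : Quad D) (z : I × I) : Q.toContinuousMap z = Q z := rfl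

/-- `toContinuousMap_injective`: structural lemma for the definitions above. [folklore] -/
theorem toContinuousMap_injective : Function.Injective (toContinuousMap (D := D)) := by
  rintro ⟨f, _, _, _⟩ ⟨g, _, _, _⟩ h
  congr
  exact congrArg (fun F : C(I × I, ℂ) => (F : I × I → ℂ)) h

/-- `ext`: structural lemma for the definitions above. [folklore] -/
@[ext] theorem ext {Q Q' : Quad D} (h : ∀ z, Q z = Q' z) : Q = Q' :=
  toContinuousMap_injective (ContinuousMap.ext h)

/-- **The uniform metric** `d(Q₁, Q₂) = sup_z |Q₁(z) − Q₂(z)|` on `𝒬_D`, induced from the sup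
metric of `C([0,1]², ℂ)`. [cite: SchrammSmirnov2011, §1.3] -/
instance instMetricSpace : MetricSpace (Quad D) :=
  MetricSpace.induced toContinuousMap toContinuousMap_injective inferInstance

/-- `dist_eq`: structural lemma for the definitions above. [folklore] -/
theorem dist_eq (Q Q' : Quad D) : dist Q Q' = dist Q.toContinuousMap Q'.toContinuousMap := rfl

/-- The distance of quads dominates the pointwise distances. [cite: SchrammSmirnov2011, §1.3] -/
theorem dist_apply_le (Q Q' : Quad D) (z : I × I) : dist (Q z) (Q' z) ≤ dist Q Q' :=
  ContinuousMap.dist_apply_le_dist (f := Q.toContinuousMap) (g := Q'.toContinuousMap) z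

/-- `continuous_toContinuousMap`: structural lemma for the definitions above. [folklore] -/
theorem continuous_toContinuousMap : Continuous (toContinuousMap (D := D)) :=
  continuous_induced_dom

/-- Evaluation `(Q, z) ↦ Q z` is continuous. [folklore] -/
theorem continuous_eval : Continuous fun p : Quad D × (I × I) => p.1 p.2 :=
  (ContinuousEval.continuous_eval : Continuous fun p : C(I × I, ℂ) × (I × I) => p.1 p.2).comp
    (continuous_toContinuousMap.prodMap continuous_id)

/-- `[Q] := Q([0,1]²)`. [cite: SchrammSmirnov2011, §1.3] -/
def carrier (Q : Quad D) : Set ℂ := range Q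

/-- `carrier_subset`: structural lemma for the definitions above. [folklore] -/
theorem carrier_subset (Q : Quad D) : Q.carrier ⊆ D := Q.range_subset

/-- `isCompact_carrier`: structural lemma for the definitions above. [folklore] -/
theorem isCompact_carrier (Q : Quad D) : IsCompact Q.carrier :=
  isCompact_range Q.continuous_toFun

/-- The four sides `∂₀Q = Q({0} × [0,1])`, `∂₁Q = Q([0,1] × {0})`, `∂₂Q = Q({1} × [0,1])`,
`∂₃Q = Q([0,1] × {1})` (indices mod `4`, counterclockwise). [cite: SchrammSmirnov2011, §1.3] -/
def side (Q : Quad D) (k : Fin 4) : Set ℂ :=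
  match k with
  | 0 => Q '' {z | z.1 = 0}
  | 1 => Q '' {z | z.2 = 0}
  | 2 => Q '' {z | z.1 = 1}
  | 3 => Q '' {z | z.2 = 1}

/-- `side_subset_carrier`: structural lemma for the definitions above. [folklore] -/
theorem side_subset_carrier (Q : Quad D) (k : Fin 4) : Q.side k ⊆ Q.carrier := by
  match k with
  | 0 => exact image_subset_range _ _
  | 1 => exact image_subset_range _ _
  | 2 => exact image_subset_range _ _
  | 3 => exact image_subset_range _ _

/-- **A crossing of `Q`**: "a connected compact subset of `[Q]` that intersects both opposite
sides `∂₀Q` and `∂₂Q`". [cite: SchrammSmirnov2011, §1.3] -/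
def IsCrossing (Q : Quad D) (K : Set ℂ) : Prop :=
  IsCompact K ∧ IsConnected K ∧ K ⊆ Q.carrier ∧ (K ∩ Q.side 0).Nonempty ∧ (K ∩ Q.side 2).Nonempty

/-- The whole quad is a crossing of itself. [folklore] -/
theorem isCrossing_carrier (Q : Quad D) : Q.IsCrossing Q.carrier := by
  refine ⟨Q.isCompact_carrier, ?_, Subset.rfl, ?_, ?_⟩
  · exact (isConnected_range Q.continuous_toFun)
  · rw [inter_eq_right.mpr (Q.side_subset_carrier 0)]
    exact ⟨Q (0, 0), ⟨(0, 0), rfl, rfl⟩⟩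
  · rw [inter_eq_right.mpr (Q.side_subset_carrier 2)]
    exact ⟨Q (1, 0), ⟨(1, 0), rfl, rfl⟩⟩

/-- **`Q₁ ≤ Q₂`** (Schramm–Smirnov): "every crossing of `Q₂` contains a crossing of `Q₁`".  A
preorder on `𝒬_D` (not antisymmetric, because quads are parametrised); written `Dominated` to keep
Mathlib's `<` (which would mean `≤ ∧ ¬ ≥`) away from the source's `<`.
[cite: SchrammSmirnov2011, §1.3] -/
def Dominated (Q₁ Q₂ : Quad D) : Prop :=
  ∀ K, Q₂.IsCrossing K → ∃ K' ⊆ K, Q₁.IsCrossing K'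

/-- **`Q₁ < Q₂`** (Schramm–Smirnov): `Q ≤ Q'` for all `Q` near `Q₁` and `Q'` near `Q₂`; "the set
of pairs `(Q, Q')` satisfying `Q < Q'` is the interior of `{(Q, Q') : Q ≤ Q'}` in the product
topology" — taken as the definition. [cite: SchrammSmirnov2011, §1.3] -/
def StrictlyDominated (Q₁ Q₂ : Quad D) : Prop :=
  (Q₁, Q₂) ∈ interior {p : Quad D × Quad D | Dominated p.1 p.2}

/-- `Dominated.refl`: structural lemma for the definitions above. [folklore] -/
theorem Dominated.refl (Q : Quad D) : Dominated Q Q := fun K hK => ⟨K, Subset.rfl, hK⟩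

/-- `Dominated.rfl`: structural lemma for the definitions above. [folklore] -/
theorem Dominated.rfl {Q : Quad D} : Dominated Q Q := Dominated.refl Q

/-- `Dominated.trans`: structural lemma for the definitions above. [folklore] -/
theorem Dominated.trans {Q₁ Q₂ Q₃ : Quad D} (h₁ : Dominated Q₁ Q₂) (h₂ : Dominated Q₂ Q₃) :
    Dominated Q₁ Q₃ := fun K hK => by
  obtain ⟨K', hK'K, hK'⟩ := h₂ K hK
  obtain ⟨K'', hK''K', hK''⟩ := h₁ K' hK'
  exact ⟨K'', hK''K'.trans hK'K, hK''⟩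

/-- `Q₁ < Q₂` implies `Q₁ ≤ Q₂`. [cite: SchrammSmirnov2011, §1.3] -/
theorem StrictlyDominated.dominated {Q₁ Q₂ : Quad D} (h : StrictlyDominated Q₁ Q₂) :
    Dominated Q₁ Q₂ :=
  interior_subset (s := {p : Quad D × Quad D | Dominated p.1 p.2}) h

/-- The printed form of `<`: open neighbourhoods `U₁ ∋ Q₁`, `U₂ ∋ Q₂` with `Q ≤ Q'` for all
`Q ∈ U₁`, `Q' ∈ U₂`. [cite: SchrammSmirnov2011, §1.3] -/
theorem strictlyDominated_iff {Q₁ Q₂ : Quad D} : StrictlyDominated Q₁ Q₂ ↔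
    ∃ U₁ U₂ : Set (Quad D), IsOpen U₁ ∧ IsOpen U₂ ∧ Q₁ ∈ U₁ ∧ Q₂ ∈ U₂ ∧
      ∀ Q ∈ U₁, ∀ Q' ∈ U₂, Dominated Q Q' := by
  rw [StrictlyDominated, mem_interior_iff_mem_nhds, mem_nhds_prod_iff']
  constructor
  · rintro ⟨U₁, U₂, hU₁, h₁, hU₂, h₂, hsub⟩
    exact ⟨U₁, U₂, hU₁, hU₂, h₁, h₂, fun Q hQ Q' hQ' => hsub (mk_mem_prod hQ hQ')⟩
  · rintro ⟨U₁, U₂, hU₁, hU₂, h₁, h₂, h⟩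
    exact ⟨U₁, U₂, hU₁, h₁, hU₂, h₂, fun p hp => h p.1 hp.1 p.2 hp.2⟩

/-- Composition of a quad with a continuous injective plane map carrying `D` into `D'` (used for
dilations and Euclidean motions). [folklore] -/
def mapContinuous (Q : Quad D) (g : ℂ → ℂ) (hg : Continuous g) (hinj : Function.Injective g)
    (hD : MapsTo g D D') : Quad D' where
  toFun := g ∘ Q
  continuous_toFun := hg.comp Q.continuous_toFun
  injective_toFun := hinj.comp Q.injective_toFun
  range_subset := by
    rintro _ ⟨z, rfl⟩
    exact hD (Q.range_subset ⟨z, rfl⟩)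

/-- `mapContinuous_apply`: structural lemma for the definitions above. [folklore] -/
@[simp] theorem mapContinuous_apply (Q : Quad D) (g : ℂ → ℂ) (hg : Continuous g)
    (hinj : Function.Injective g) (hD : MapsTo g D D') (z : I × I) :
    Q.mapContinuous g hg hinj hD z = g (Q z) := rfl

/-- **Dilation** `S_t Q = t · Q` of a quad of the whole plane (`t ≠ 0`). [cite: SchrammSmirnov2011, §1.4 (scaling limit)] -/
def dilate (t : ℝ) (ht : t ≠ 0) (Q : Quad (univ : Set ℂ)) : Quad (univ : Set ℂ) :=
  Q.mapContinuous (fun w => (t : ℂ) * w) (continuous_const.mul continuous_id)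
    (mul_right_injective₀ (Complex.ofReal_ne_zero.mpr ht)) (mapsTo_univ _ _)

/-- The image of a quad of the whole plane under a Euclidean motion (any self-isometry of `ℂ`). [folklore] -/
def isometry (g : ℂ ≃ᵢ ℂ) (Q : Quad (univ : Set ℂ)) : Quad (univ : Set ℂ) :=
  Q.mapContinuous g g.continuous g.injective (mapsTo_univ _ _)

/-- **The unit square** `z = (s, t) ↦ s + it` as a quad of the plane (non-vacuity of `Quad`).
[folklore] -/
def unitSquare : Quad (univ : Set ℂ) where
  toFun z := ((z.1 : ℝ) : ℂ) + ((z.2 : ℝ) : ℂ) * Complex.I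
  continuous_toFun := by fun_prop
  injective_toFun := by
    rintro ⟨s, t⟩ ⟨s', t'⟩ h
    have h1 := congrArg Complex.re h
    have h2 := congrArg Complex.im h
    simp only [Complex.add_re, Complex.ofReal_re, Complex.mul_re, Complex.I_re, mul_zero,
      Complex.ofReal_im, Complex.I_im, mul_one, sub_self, add_zero, Complex.add_im,
      Complex.mul_im, zero_add] at h1 h2
    exact Prod.ext (Subtype.ext h1) (Subtype.ext h2)
  range_subset := subset_univ _

end Quad

/-! ### The space `ℋ_D` of closed lower sets and its topology -/

variable {D : Set ℂ}

/-- **Lower set of quads** (Schramm–Smirnov): `Q ∈ S` and `Q' < Q` imply `Q' ∈ S`.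
[cite: SchrammSmirnov2011, §1.3] -/
def IsLowerQuadSet (S : Set (Quad D)) : Prop :=
  ∀ ⦃Q⦄, Q ∈ S → ∀ ⦃Q'⦄, Quad.StrictlyDominated Q' Q → Q' ∈ S

variable (D) in
/-- **`ℋ_D`, the space of percolation configurations**: the closed lower subsets of `𝒬_D`
("which one should think of as sets of quads crossed"). [cite: SchrammSmirnov2011, §1.3] -/
def QuadConfig : Type := {S : Set (Quad D) // IsClosed S ∧ IsLowerQuadSet S}

namespace QuadConfig

/-- The instance `instSetLike` (see the module docstring). [folklore] -/
instance instSetLike : SetLike (QuadConfig D) (Quad D) where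
  coe S := S.1
  coe_injective _ _ h := Subtype.ext h

/-- `mem_coe`: structural lemma for the definitions above. [folklore] -/
@[simp] theorem mem_coe {S : QuadConfig D} {Q : Quad D} : Q ∈ (S : Set (Quad D)) ↔ Q ∈ S :=
  Iff.rfl

/-- `ext`: structural lemma for the definitions above. [folklore] -/
@[ext] theorem ext {S T : QuadConfig D} (h : ∀ Q, Q ∈ S ↔ Q ∈ T) : S = T := SetLike.ext h

/-- `isClosed`: structural lemma for the definitions above. [folklore] -/
theorem isClosed (S : QuadConfig D) : IsClosed (S : Set (Quad D)) := S.2.1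

/-- `isLowerQuadSet`: structural lemma for the definitions above. [folklore] -/
theorem isLowerQuadSet (S : QuadConfig D) : IsLowerQuadSet (S : Set (Quad D)) := S.2.2

/-- The configuration in which no quad is crossed. [cite: SchrammSmirnov2011, §1.3] -/
def none : QuadConfig D := ⟨∅, isClosed_empty, fun _ h => h.elim⟩

/-- The configuration in which every quad is crossed. [cite: SchrammSmirnov2011, §1.3] -/
def all : QuadConfig D := ⟨Set.univ, isClosed_univ, fun _ _ _ _ => mem_univ _⟩

/-- `not_mem_none`: structural lemma for the definitions above. [folklore] -/
@[simp] theorem not_mem_none (Q : Quad D) : Q ∉ (none : QuadConfig D) := fun h => h.elim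

/-- `mem_all`: structural lemma for the definitions above. [folklore] -/
@[simp] theorem mem_all (Q : Quad D) : Q ∈ (all : QuadConfig D) := mem_univ _

/-- The subbasic sets `V_U = {S : S ∩ U ≠ ∅}` ("some quads from `U` are crossed"), `U` open.
[cite: SchrammSmirnov2011, §1.3] -/
def someCrossed (U : Set (Quad D)) : Set (QuadConfig D) := {S | ((S : Set (Quad D)) ∩ U).Nonempty}

/-- The subbasic sets `V^Q = {S : Q ∉ S}` ("`Q` is not crossed"). [cite: SchrammSmirnov2011, §1.3] -/
def notCrossed (Q : Quad D) : Set (QuadConfig D) := {S | Q ∉ S}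

/-- **The topology `𝒯_D`**: "the minimal topology which contains every such `V_U` and `V^Q`".
[cite: SchrammSmirnov2011, §1.3] -/
instance instTopologicalSpace : TopologicalSpace (QuadConfig D) :=
  TopologicalSpace.generateFrom
    ({V | ∃ U : Set (Quad D), IsOpen U ∧ V = someCrossed U} ∪ {V | ∃ Q : Quad D, V = notCrossed Q})

/-- The Borel `σ`-algebra of `𝒯_D` ("the scaling limit measure is a Borel probability measure on
`ℋ`"). [cite: SchrammSmirnov2011, §1.3] -/
instance instMeasurableSpace : MeasurableSpace (QuadConfig D) := borel (QuadConfig D)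

/-- The instance `instBorelSpace` (see the module docstring). [folklore] -/
instance instBorelSpace : BorelSpace (QuadConfig D) := ⟨rfl⟩

/-- `isOpen_someCrossed`: structural lemma for the definitions above. [folklore] -/
theorem isOpen_someCrossed {U : Set (Quad D)} (hU : IsOpen U) : IsOpen (someCrossed U) :=
  TopologicalSpace.isOpen_generateFrom_of_mem (Or.inl ⟨U, hU, rfl⟩)

/-- `isOpen_notCrossed`: structural lemma for the definitions above. [folklore] -/
theorem isOpen_notCrossed (Q : Quad D) : IsOpen (notCrossed Q) :=
  TopologicalSpace.isOpen_generateFrom_of_mem (Or.inr ⟨Q, rfl⟩)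

/-- **The crossing event `⊞_Q = {S : Q ∈ S}`** ("the event of a percolation configuration
crossing a quad `Q`"). [cite: SchrammSmirnov2011, §1.3] -/
def crossedEvent (Q : Quad D) : Set (QuadConfig D) := {S | Q ∈ S}

/-- `mem_crossedEvent`: structural lemma for the definitions above. [folklore] -/
@[simp] theorem mem_crossedEvent {Q : Quad D} {S : QuadConfig D} : S ∈ crossedEvent Q ↔ Q ∈ S :=
  Iff.rfl

/-- `compl_crossedEvent`: structural lemma for the definitions above. [folklore] -/
theorem compl_crossedEvent (Q : Quad D) : (crossedEvent Q)ᶜ = notCrossed Q := rfl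

/-- `⊞_Q` is closed (its complement `V^Q` is subbasic open). [cite: SchrammSmirnov2011, §1.3] -/
theorem isClosed_crossedEvent (Q : Quad D) : IsClosed (crossedEvent Q) :=
  ⟨by rw [compl_crossedEvent]; exact isOpen_notCrossed Q⟩

/-- `⊞_Q` is a Borel event. [cite: SchrammSmirnov2011, §1.3] -/
theorem measurableSet_crossedEvent (Q : Quad D) : MeasurableSet (crossedEvent Q) :=
  (isClosed_crossedEvent Q).measurableSet

/-- Inclusion of configurations (more quads crossed): the partial order in which *increasing*
events are upper sets. [cite: SchrammSmirnov2011, §1.3] -/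
instance instPartialOrder : PartialOrder (QuadConfig D) := PartialOrder.lift _ SetLike.coe_injective

/-- `le_iff`: structural lemma for the definitions above. [folklore] -/
theorem le_iff {S T : QuadConfig D} : S ≤ T ↔ (S : Set (Quad D)) ⊆ T := Iff.rfl

/-- Crossing events are increasing. [cite: SchrammSmirnov2011, §1.3] -/
theorem isUpperSet_crossedEvent (Q : Quad D) : IsUpperSet (crossedEvent Q) :=
  fun _ _ hST hS => hST hS

/-! ### Closed lower sets from `≤`-lower sets -/

/-- **The closure of a `≤`-lower set of quads is a (`<`-)lower set**: if `Q` is a limit of quads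
of `S₀` and `Q' < Q`, then `Q' ≤ Q₁` for some `Q₁ ∈ S₀` close to `Q` (definition of `<`), so
`Q' ∈ S₀`. [folklore] -/
theorem isLowerQuadSet_closure {S₀ : Set (Quad D)}
    (h : ∀ ⦃Q⦄, Q ∈ S₀ → ∀ ⦃Q'⦄, Quad.Dominated Q' Q → Q' ∈ S₀) :
    IsLowerQuadSet (closure S₀) := by
  intro Q hQ Q' hlt
  obtain ⟨U₁, U₂, -, hU₂, h₁, h₂, hdom⟩ := Quad.strictlyDominated_iff.mp hlt
  obtain ⟨Q₁, hQ₁U, hQ₁S⟩ := mem_closure_iff.mp hQ U₂ hU₂ h₂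
  exact subset_closure (h hQ₁S (hdom Q' h₁ Q₁ hQ₁U))

/-- The element of `ℋ_D` generated by a `≤`-lower set of quads: its closure. [folklore] -/
def ofDominatedLower (S₀ : Set (Quad D))
    (h : ∀ ⦃Q⦄, Q ∈ S₀ → ∀ ⦃Q'⦄, Quad.Dominated Q' Q → Q' ∈ S₀) : QuadConfig D :=
  ⟨closure S₀, isClosed_closure, isLowerQuadSet_closure h⟩

/-- `coe_ofDominatedLower`: structural lemma for the definitions above. [folklore] -/
@[simp] theorem coe_ofDominatedLower (S₀ : Set (Quad D))
    (h : ∀ ⦃Q⦄, Q ∈ S₀ → ∀ ⦃Q'⦄, Quad.Dominated Q' Q → Q' ∈ S₀) :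
    (ofDominatedLower S₀ h : Set (Quad D)) = closure S₀ := rfl

/-- `subset_ofDominatedLower`: structural lemma for the definitions above. [folklore] -/
theorem subset_ofDominatedLower (S₀ : Set (Quad D))
    (h : ∀ ⦃Q⦄, Q ∈ S₀ → ∀ ⦃Q'⦄, Quad.Dominated Q' Q → Q' ∈ S₀) :
    S₀ ⊆ (ofDominatedLower S₀ h : Set (Quad D)) := subset_closure

end QuadConfig

/-! ### The named fact: Theorem 1.4 (1)–(2) -/

/-- **Schramm–Smirnov, Theorem 1.4 (1)–(2)** ("The space of percolation configurations"): "Let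
`D ⊂ ℂ̂` be topologically open and nonempty.  (1) `(ℋ_D, 𝒯_D)` is a compact metrizable Hausdorff
space.  (2) Let `A` be a dense subset of `𝒬_D`.  If `S₁, S₂ ∈ ℋ_D` satisfy `S₁ ∩ A = S₂ ∩ A`, then
`S₁ = S₂`.  Moreover, the `σ`-field generated by `V^Q`, `Q ∈ A` is the Borel `σ`-field of
`(ℋ_D, 𝒯_D)`."  Vendored for open nonempty `D ⊆ ℂ` (the source allows `D ⊂ ℂ̂`; the plane case is
what the consumers use), with "metrizable" as Mathlib's `TopologicalSpace.MetrizableSpace`.  With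
Cor. 1.5–1.6 (Banach–Alaoglu) it yields the existence of subsequential scaling limits
(`IsSubseqQuadLimit`).  Named fact (D-0014), not proved here.
[cite: SchrammSmirnov2011, Thm. 1.4 (1)–(2)] -/
def SchrammSmirnov2011_thm_1_4 : Prop :=
  ∀ (D : Set ℂ), IsOpen D → D.Nonempty →
    (CompactSpace (QuadConfig D) ∧ TopologicalSpace.MetrizableSpace (QuadConfig D) ∧
      T2Space (QuadConfig D)) ∧
    ∀ A : Set (Quad D), Dense A →
      (∀ S₁ S₂ : QuadConfig D, (S₁ : Set (Quad D)) ∩ A = (S₂ : Set (Quad D)) ∩ A → S₁ = S₂) ∧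
      MeasurableSpace.generateFrom ((fun Q => QuadConfig.notCrossed Q) '' A) =
        borel (QuadConfig D)

/-! ### Discrete configurations: quads crossed by the open edges -/

section Discrete

variable {V : Type*}

/-- **The plane realisation of the open edges** of a bond configuration `ω` whose vertices sit
at `z : V → ℂ`, at mesh `δ`: the union of the closed segments `[δ z x, δ z y]` over the open edges
`s(x, y) ∈ ω`.  (H21 rendering of "a crossing formed by an open cluster" for bond percolation drawn
in the plane; Schramm–Smirnov phrase the discrete side with colourings of trivalent tilings.)
[cite: SchrammSmirnov2011, §1.3] -/
def openEdgeRealization (z : V → ℂ) (δ : ℝ) (ω : BondConfig V) : Set ℂ :=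
  {w | ∃ x y : V, s(x, y) ∈ ω ∧ w ∈ segment ℝ ((δ : ℂ) * z x) ((δ : ℂ) * z y)}

/-- The quads of `D` **crossed by `ω`**: those having a crossing inside the realisation of the open
edges ("the set of all quads for which `ω` contains a crossing formed by an open cluster").
[cite: SchrammSmirnov2011, §1.3] -/
def rawCrossedQuads (z : V → ℂ) (δ : ℝ) (ω : BondConfig V) (D : Set ℂ) : Set (Quad D) :=
  {Q | ∃ K, Q.IsCrossing K ∧ K ⊆ openEdgeRealization z δ ω}

/-- The crossed quads form a `≤`-lower set ("crossing of a quad automatically contains crossings of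
'shorter' sub-quads"). [cite: SchrammSmirnov2011, §1.3] -/
theorem rawCrossedQuads_lower (z : V → ℂ) (δ : ℝ) (ω : BondConfig V) (D : Set ℂ) :
    ∀ ⦃Q⦄, Q ∈ rawCrossedQuads z δ ω D → ∀ ⦃Q'⦄, Quad.Dominated Q' Q →
      Q' ∈ rawCrossedQuads z δ ω D := by
  rintro Q ⟨K, hK, hKω⟩ Q' hdom
  obtain ⟨K', hK'K, hK'⟩ := hdom K hK
  exact ⟨K', hK', hK'K.trans hKω⟩

/-- **`S_ω ∈ ℋ_D`**, the configuration of quads crossed by `ω` (vertex positions `z`, mesh `δ`):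
the closure of `rawCrossedQuads` (a closed `<`-lower set by `isLowerQuadSet_closure`; for the
locally finite realisations of lattice configurations the raw set is already closed — limits of
crossings of `Qₙ → Q` inside a closed set are crossings of `Q` — so this is Schramm–Smirnov's
`S_ω`; that closedness lemma is not needed for the definition and is not proved here).
[cite: SchrammSmirnov2011, §1.3] -/
def configOf (z : V → ℂ) (δ : ℝ) (D : Set ℂ) (ω : BondConfig V) : QuadConfig D :=
  QuadConfig.ofDominatedLower (rawCrossedQuads z δ ω D) (rawCrossedQuads_lower z δ ω D)

/-- `rawCrossedQuads_subset_configOf`: structural lemma for the definitions above. [folklore] -/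
theorem rawCrossedQuads_subset_configOf (z : V → ℂ) (δ : ℝ) (D : Set ℂ) (ω : BondConfig V) :
    rawCrossedQuads z δ ω D ⊆ (configOf z δ D ω : Set (Quad D)) :=
  QuadConfig.subset_ofDominatedLower _ _

variable [MeasurableSpace (BondConfig V)] in
/-- **The law `μ` of the crossed-quad configuration** under a bond-percolation law `P`, at mesh
`δ`: the push-forward `P ∘ (configOf z δ D)⁻¹`, as a finite measure on `(ℋ_D, Borel 𝒯_D)`
("a percolation model … induces a probability measure `μ_η` on `ℋ`").  Mathlib's `Measure.map`
returns `0` for a non-measurable map; measurability of `configOf` (from Thm. 1.4 (2): it suffices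
that each `{ω : Q ∈ S_ω}` be an event, and this event depends on the finitely many edges meeting
`[Q]`) is a theorem left to a proof file. [cite: SchrammSmirnov2011, §1.3] -/
def crossingLaw (P : Measure (BondConfig V)) [IsFiniteMeasure P] (z : V → ℂ) (δ : ℝ)
    (D : Set ℂ) : FiniteMeasure (QuadConfig D) :=
  ⟨P.map (configOf z δ D), inferInstance⟩

end Discrete

/-! ### Bond percolation on `ℤ²` at `p = 1/2`: laws, subsequential scaling limits, the FKG order -/

open Literature.Probability.LatticeModels

/-- **`μ_δ`**: the law on `ℋ_D` of the quads crossed by critical (`p = 1/2`) bond percolation on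
`δℤ²` (positions `squareLatticeEmbedding.z`, law `bondPercolation (zdGraph 2) half`).
[cite: SchrammSmirnov2011, §1.3 and Cor. 1.6] -/
def squareCrossingLaw (D : Set ℂ) (δ : ℝ) : FiniteMeasure (QuadConfig D) :=
  crossingLaw (bondPercolation (zdGraph 2) half) squareLatticeEmbedding.z δ D

/-- **Subsequential scaling limit** of critical bond percolation on `ℤ²` in the quad-crossing
space: `μ` is the weak limit of `μ_{δₖ}` along some sequence of meshes `δₖ → 0⁺` (Mathlib's
topology of weak convergence on finite measures; sequences suffice, Remark 8).  Existence of such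
`μ` is Cor. 1.6 (from Thm. 1.4 (1)). [cite: SchrammSmirnov2011, Cor. 1.6 and Remark 8] -/
def IsSubseqQuadLimit (D : Set ℂ) (μ : FiniteMeasure (QuadConfig D)) : Prop :=
  ∃ δs : ℕ → ℝ, (∀ k, 0 < δs k) ∧ Tendsto δs atTop (𝓝 0) ∧
    Tendsto (fun k => squareCrossingLaw D (δs k)) atTop (𝓝 μ)

/-- The set `Λ` of subsequential scaling limits (route `CardyOrderDuality`). [cite: SchrammSmirnov2011, Cor. 1.6] -/
def subseqQuadLimits (D : Set ℂ) : Set (FiniteMeasure (QuadConfig D)) := {μ | IsSubseqQuadLimit D μ}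

/-- An event of `ℋ_D` is a **crossing cylinder** if it is measurable with respect to finitely
many crossing events `⊞_Q` ("events generated by finitely many quad-crossing events").
[cite: SchrammSmirnov2011, §1.3] -/
def IsCrossingCylinder (A : Set (QuadConfig D)) : Prop :=
  ∃ F : Set (Quad D), F.Finite ∧
    MeasurableSet[MeasurableSpace.generateFrom ((fun Q => QuadConfig.crossedEvent Q) '' F)] A

/-- **The stochastic (FKG) order on laws**: `μ ≼ ν` iff `μ A ≤ ν A` for every increasing
crossing cylinder `A` (increasing = upper set for inclusion of configurations).  The equivalent
form "there is a monotone coupling" (Strassen) is a theorem and is not restated. [folklore] -/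
def StochDominated (μ ν : FiniteMeasure (QuadConfig D)) : Prop :=
  ∀ A : Set (QuadConfig D), IsUpperSet A → IsCrossingCylinder A → (μ : Measure (QuadConfig D)) A ≤
    (ν : Measure (QuadConfig D)) A

/-- `StochDominated.refl`: structural lemma for the definitions above. [folklore] -/
theorem StochDominated.refl (μ : FiniteMeasure (QuadConfig D)) : StochDominated μ μ :=
  fun _ _ _ => le_rfl

/-- `StochDominated.trans`: structural lemma for the definitions above. [folklore] -/
theorem StochDominated.trans {μ ν ρ : FiniteMeasure (QuadConfig D)} (h₁ : StochDominated μ ν)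
    (h₂ : StochDominated ν ρ) : StochDominated μ ρ :=
  fun A hA hC => (h₁ A hA hC).trans (h₂ A hA hC)

/-! ### Dilations and motions of the plane acting on quads, on `ℋ`, and on laws -/

namespace Quad

variable (g : ℂ ≃ₜ ℂ)

/-- The image `g ∘ Q` of a quad of the whole plane under a plane homeomorphism `g`. [folklore] -/
def mapHomeomorph (Q : Quad (univ : Set ℂ)) : Quad (univ : Set ℂ) :=
  Q.mapContinuous g g.continuous g.injective (mapsTo_univ _ _)

/-- `mapHomeomorph_apply`: structural lemma for the definitions above. [folklore] -/
@[simp] theorem mapHomeomorph_apply (Q : Quad (univ : Set ℂ)) (z : I × I) :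
    Q.mapHomeomorph g z = g (Q z) := rfl

/-- `mapHomeomorph_symm_mapHomeomorph`: structural lemma for the definitions above. [folklore] -/
@[simp] theorem mapHomeomorph_symm_mapHomeomorph (Q : Quad (univ : Set ℂ)) :
    (Q.mapHomeomorph g).mapHomeomorph g.symm = Q := by
  ext z; simp

/-- `mapHomeomorph_mapHomeomorph_symm`: structural lemma for the definitions above. [folklore] -/
@[simp] theorem mapHomeomorph_mapHomeomorph_symm (Q : Quad (univ : Set ℂ)) :
    (Q.mapHomeomorph g.symm).mapHomeomorph g = Q := by
  ext z; simp

/-- `toContinuousMap_mapHomeomorph`: structural lemma for the definitions above. [folklore] -/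
theorem toContinuousMap_mapHomeomorph (Q : Quad (univ : Set ℂ)) :
    (Q.mapHomeomorph g).toContinuousMap = (⟨g, g.continuous⟩ : C(ℂ, ℂ)).comp Q.toContinuousMap :=
  rfl

/-- `Q ↦ g ∘ Q` is continuous in the uniform metric (composition is continuous for the
compact-open = uniform topology). [folklore] -/
theorem continuous_mapHomeomorph : Continuous (mapHomeomorph g) := by
  refine continuous_induced_rng.mpr ?_
  have : (toContinuousMap ∘ mapHomeomorph g) =
      (ContinuousMap.comp (⟨g, g.continuous⟩ : C(ℂ, ℂ))) ∘ toContinuousMap := rfl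
  rw [this]
  exact (ContinuousMap.continuous_postcomp _).comp continuous_toContinuousMap

/-- `carrier_mapHomeomorph`: structural lemma for the definitions above. [folklore] -/
theorem carrier_mapHomeomorph (Q : Quad (univ : Set ℂ)) :
    (Q.mapHomeomorph g).carrier = g '' Q.carrier := by
  simp only [carrier]
  exact Set.range_comp g Q.toFun

/-- `side_mapHomeomorph`: structural lemma for the definitions above. [folklore] -/
theorem side_mapHomeomorph (Q : Quad (univ : Set ℂ)) (k : Fin 4) :
    (Q.mapHomeomorph g).side k = g '' Q.side k := by
  match k with
  | 0 => exact Set.image_comp g Q.toFun _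
  | 1 => exact Set.image_comp g Q.toFun _
  | 2 => exact Set.image_comp g Q.toFun _
  | 3 => exact Set.image_comp g Q.toFun _

/-- Plane homeomorphisms carry crossings to crossings. [folklore] -/
theorem IsCrossing.image {Q : Quad (univ : Set ℂ)} {K : Set ℂ} (h : Q.IsCrossing K) :
    (Q.mapHomeomorph g).IsCrossing (g '' K) := by
  obtain ⟨hc, hconn, hsub, h0, h2⟩ := h
  refine ⟨hc.image g.continuous, hconn.image _ g.continuous.continuousOn, ?_, ?_, ?_⟩
  · rw [carrier_mapHomeomorph]; exact image_mono hsub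
  · rw [side_mapHomeomorph, ← image_inter g.injective]; exact h0.image g
  · rw [side_mapHomeomorph, ← image_inter g.injective]; exact h2.image g

/-- The crossings of `g ∘ Q` are the images of the crossings of `Q`. [folklore] -/
theorem isCrossing_mapHomeomorph_iff {Q : Quad (univ : Set ℂ)} {K : Set ℂ} :
    (Q.mapHomeomorph g).IsCrossing K ↔ Q.IsCrossing (g.symm '' K) := by
  constructor
  · intro h
    simpa only [mapHomeomorph_symm_mapHomeomorph] using h.image g.symm
  · intro h
    have := h.image g
    rwa [Set.image_image, show (fun x => g (g.symm x)) = id from funext g.apply_symm_apply,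
      Set.image_id] at this

/-- Plane homeomorphisms preserve the order `≤` of quads. [folklore] -/
theorem Dominated.mapHomeomorph {Q₁ Q₂ : Quad (univ : Set ℂ)} (h : Dominated Q₁ Q₂) :
    Dominated (Q₁.mapHomeomorph g) (Q₂.mapHomeomorph g) := by
  intro K hK
  rw [isCrossing_mapHomeomorph_iff] at hK
  obtain ⟨K', hK'K, hK'⟩ := h _ hK
  refine ⟨g '' K', ?_, hK'.image g⟩
  calc g '' K' ⊆ g '' (g.symm '' K) := image_mono hK'K
    _ = K := by rw [Set.image_image, show (fun x => g (g.symm x)) = id from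
        funext g.apply_symm_apply, Set.image_id]

/-- `dominated_mapHomeomorph_iff`: structural lemma for the definitions above. [folklore] -/
theorem dominated_mapHomeomorph_iff {Q₁ Q₂ : Quad (univ : Set ℂ)} :
    Dominated (Q₁.mapHomeomorph g) (Q₂.mapHomeomorph g) ↔ Dominated Q₁ Q₂ :=
  ⟨fun h => by simpa only [mapHomeomorph_symm_mapHomeomorph] using h.mapHomeomorph g.symm,
    fun h => h.mapHomeomorph g⟩

/-- The self-homeomorphism `Q ↦ g ∘ Q` of the quad space of the plane. [folklore] -/
def congrHomeomorph : Quad (univ : Set ℂ) ≃ₜ Quad (univ : Set ℂ) where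
  toFun := mapHomeomorph g
  invFun := mapHomeomorph g.symm
  left_inv Q := mapHomeomorph_symm_mapHomeomorph g Q
  right_inv Q := mapHomeomorph_mapHomeomorph_symm g Q
  continuous_toFun := continuous_mapHomeomorph g
  continuous_invFun := continuous_mapHomeomorph g.symm

/-- `congrHomeomorph_apply`: structural lemma for the definitions above. [folklore] -/
@[simp] theorem congrHomeomorph_apply (Q : Quad (univ : Set ℂ)) :
    congrHomeomorph g Q = Q.mapHomeomorph g := rfl

/-- Plane homeomorphisms preserve the strict order `<` of quads (`g × g` is a homeomorphism of
`𝒬 × 𝒬` mapping the relation `≤` onto itself, hence its interior onto itself). [folklore] -/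
theorem StrictlyDominated.mapHomeomorph {Q₁ Q₂ : Quad (univ : Set ℂ)}
    (h : StrictlyDominated Q₁ Q₂) :
    StrictlyDominated (Q₁.mapHomeomorph g) (Q₂.mapHomeomorph g) := by
  let Φ : Quad (univ : Set ℂ) × Quad (univ : Set ℂ) ≃ₜ Quad (univ : Set ℂ) × Quad (univ : Set ℂ) :=
    (congrHomeomorph g).prodCongr (congrHomeomorph g)
  have hR : Φ '' {p : Quad (univ : Set ℂ) × Quad (univ : Set ℂ) | Dominated p.1 p.2} =
      {p | Dominated p.1 p.2} := by
    ext p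
    constructor
    · rintro ⟨q, hq, rfl⟩
      exact (Dominated.mapHomeomorph g hq :)
    · intro hp
      refine ⟨(p.1.mapHomeomorph g.symm, p.2.mapHomeomorph g.symm), hp.mapHomeomorph g.symm, ?_⟩
      exact Prod.ext (mapHomeomorph_mapHomeomorph_symm g p.1) (mapHomeomorph_mapHomeomorph_symm g p.2)
  have := (Φ.image_interior {p : Quad (univ : Set ℂ) × Quad (univ : Set ℂ) | Dominated p.1 p.2}).symm
  rw [hR] at this
  show Φ (Q₁, Q₂) ∈ interior {p : Quad (univ : Set ℂ) × Quad (univ : Set ℂ) | Dominated p.1 p.2}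
  rw [this]
  exact mem_image_of_mem Φ h

end Quad

namespace QuadConfig

variable (g : ℂ ≃ₜ ℂ)

/-- **The action of a plane homeomorphism on `ℋ`**: `S ↦ {g ∘ Q : Q ∈ S}` (a closed lower set:
the image of a closed set under the homeomorphism `Q ↦ g ∘ Q`, lower by `<`-invariance).  For
`g` a dilation `w ↦ t w` this is Schramm–Smirnov's scaling `S_t`; for `g` a Euclidean motion,
the motion of configurations. [cite: SchrammSmirnov2011, §1.4 (scaling limits)] -/
def mapHomeomorph (S : QuadConfig (univ : Set ℂ)) : QuadConfig (univ : Set ℂ) :=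
  ⟨Quad.congrHomeomorph g '' (S : Set (Quad (univ : Set ℂ))),
    (Quad.congrHomeomorph g).isClosed_image.mpr S.isClosed, by
      rintro _ ⟨Q, hQ, rfl⟩ Q' hlt
      refine ⟨Q'.mapHomeomorph g.symm, S.isLowerQuadSet hQ ?_, ?_⟩
      · simpa only [Quad.congrHomeomorph_apply, Quad.mapHomeomorph_symm_mapHomeomorph] using
          hlt.mapHomeomorph g.symm
      · simp⟩

/-- `mem_mapHomeomorph`: structural lemma for the definitions above. [folklore] -/
@[simp] theorem mem_mapHomeomorph {S : QuadConfig (univ : Set ℂ)} {Q : Quad (univ : Set ℂ)} :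
    Q ∈ S.mapHomeomorph g ↔ Q.mapHomeomorph g.symm ∈ S := by
  change Q ∈ Quad.congrHomeomorph g '' (S : Set (Quad (univ : Set ℂ))) ↔ _
  constructor
  · rintro ⟨Q₀, hQ₀, rfl⟩
    simpa only [Quad.congrHomeomorph_apply, Quad.mapHomeomorph_symm_mapHomeomorph,
      SetLike.mem_coe] using hQ₀
  · intro h
    exact ⟨_, h, by simp⟩

/-- **Dilation `S_t` of configurations** (`t ≠ 0`). [cite: SchrammSmirnov2011, §1.4] -/
def dilate (t : ℝ) (ht : t ≠ 0) : QuadConfig (univ : Set ℂ) → QuadConfig (univ : Set ℂ) :=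
  mapHomeomorph (Homeomorph.mulLeft₀ (t : ℂ) (Complex.ofReal_ne_zero.mpr ht))

/-- The motion of configurations by a Euclidean motion `g` of the plane. [folklore] -/
def isometry (g : ℂ ≃ᵢ ℂ) : QuadConfig (univ : Set ℂ) → QuadConfig (univ : Set ℂ) :=
  mapHomeomorph g.toHomeomorph

end QuadConfig

/-- **Dilation of laws**: the push-forward of a law on `ℋ_ℂ` under `S_t` (the route's `S_t Λ`).
[cite: SchrammSmirnov2011, §1.4] -/
def dilateLaw (t : ℝ) (ht : t ≠ 0) (μ : FiniteMeasure (QuadConfig (univ : Set ℂ))) :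
    FiniteMeasure (QuadConfig (univ : Set ℂ)) :=
  μ.map (QuadConfig.dilate t ht)

/-- The push-forward of a law on `ℋ_ℂ` under a Euclidean motion of the plane. [folklore] -/
def isometryLaw (g : ℂ ≃ᵢ ℂ) (μ : FiniteMeasure (QuadConfig (univ : Set ℂ))) :
    FiniteMeasure (QuadConfig (univ : Set ℂ)) :=
  μ.map (QuadConfig.isometry g)

end QuadCrossing

end Literature.Probability.Percolation
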